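import Literature.MathematicalPhysics.QuantumFieldTheory.Balaban1983to89.B8Prop7TowerAxialIneq145
import Literature.MathematicalPhysics.QuantumFieldTheory.Balaban1983to89.Node00.CarriersB8SubBH

/-!
# `Balaban1983to89.B8Prop7TowerAxialRecord` — [Balaban1985RegularSpaces] **PROPOSITION 7 FOR PRINT'S TOWER-WISE AXIAL MAP, READ AT NODE 00's [B8″]
# GROUP OF RECORD** (`famB8OfRecordSubB` ∕ the repaired `famB8OfRecordSubBH` over n05-c's four-law sub-index `IdxB8SubB θ`): the candidate PIN
# `toAxialTowerResid θ β len` of the residual datum `ResidB8.toAxial` (print's map at every member of `IdxB8 θ`) and the instances of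
# `B8Prop7TowerAxialIneq145.prop7RepairedC_zdGF3_toAxialTower` there — `B8Ineq145.Prop7RepairedC (530·θ.D)` at both pins

statement-level skeleton of published theorems with citation tags; proofs where landed; nothing here is a claim about the Yang–Mills mass gap

T. Bałaban, *Spaces of regular gauge field configurations on a lattice and gauge fixing conditions*, Commun. Math. Phys. **99** (1985) 75–102
`[Balaban1985RegularSpaces]` ("B8"; journal page = PDF page + 74): Prop. 7 (1.144)–(1.145) p. 100, (1.19) p. 79, (1.29) p. 81, (1.5)–(1.6) p. 77.

## WHY THIS FILE (cell `pub-ymgap`, HUMAN RULING D-0062; R134 seat `pub-ymgap-dag-n05-c` g6, DAG node N05 = [B8]; count-neutral)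

The N05 knits of record display `p7 : B8SectGH.Prop7PrintedR (famB8OfRecordSubB θ λ.β λ.len ·) (fun j => λ.toAxial j.1)` with `λ.toAxial` FREE residual
data (`Node00.ResidB8.toAxial`), junk-dischargeable (this seat g4, `Thm/BalabanUVNodesN05Prop7UnitAxial`); ref-E READ-18: «counts only with `toAxial`
pinned to print's map».  This seat g6's bricks `B8Prop7TowerAxialZd3` ∕ `…Unitary` ∕ `…Ineq145` typed print's tower-wise map `toAxialTower` at every
member of `zdGF3` and proved `B8Ineq145.Prop7RepairedC (530·d) (zdGF3 ∘ e) (toAxialTower ∘ e)` for every index map into the `Ω₀ = ℤᵈ` members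
obeying NODE 00's located law №8.  THIS FILE reads that at NODE 00's objects: (i) `toAxialTowerResid θ β len` — the map in the TYPE of the residual
field `ResidB8.toAxial` (so a layer `{λ with toAxial := toAxialTowerResid θ λ.β λ.len}` is the honest pin of Proposition 7's axial map); (ii)
`prop7RepairedC_famB8OfRecordSubB` ∕ `prop7RepairedC_famB8OfRecordSubBH`: `B8Ineq145.Prop7RepairedC (530·θ.D)` for the [B8″] group of record and
for its repaired-carrier twin (Proposition 7 reads no source: `InA`, `C140`, `InAAx`, `avgClose` are `rfl`-equal fields), with `toAxial :=
fun j => toAxialTowerResid θ β len j.1` — at EVERY admissible `θ` (`θ.D ≥ 2`; `θ.L ≥ 2` by `Stage1Params.two_le_L`), laws from `j.2.toIdxB8Laws`,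
`Ω₀ = ℤᵈ` from `j.1.2`.  WHAT THIS IS NOT: a discharge of the knits' TYPED `p7` (`Prop7PrintedR`, constant `2`): that needs the species word
(`p7′ := Prop7RepairedC C(d)`, P7 SPECIES NOTE (S1)) at the leaf; under it, (ii) IS the supplier.

## HONEST SCOPE

One definition in the residual field's type + two instances BY NAME; NO estimate; the leaf is NOT re-typed and NO species is chosen here.  Count-neutral;
N05 NOT discharged; one finite `T⁴` programme at fixed `ε`, Bałaban as printed — nothing continuum ∕ ℝ⁴ ∕ OS ∕ mass-gap ∕ Clay.  No `sorry`, no `axiom`,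
no `instance`, no `notation`.  Unit `pub-ymgap-dag-n05-c` (g6), 2026-08-27.

[cite: Balaban1985RegularSpaces, Prop. 7 (1.144)–(1.145) p.100, (1.19) p.79, (1.29) p.81, (1.5)–(1.6) p.77]
-/

noncomputable section

namespace Literature.MathematicalPhysics.QuantumFieldTheory.Balaban1983to89.B8Prop7TowerAxialRecord

open Node00 (IdxB8 famB8OfRecord ResidB8 famB8OfRecordSubBH Stage1Params.two_le_L)
open B8IdxB8LawsB (IdxB8LawsB IdxB8SubB famB8OfRecordSubB)
open B8Prop7TowerAxialZd3 (toAxialTower)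
open B8Prop7TowerAxialIneq145 (prop7RepairedC_zdGF3_toAxialTower)

variable (θ : Node00.Stage3Params) (β : ℝ) (len : B7Prop1Explicit.Site θ.D → ℝ)

/-- **PRINT'S TOWER-WISE AXIAL MAP IN THE TYPE OF THE RESIDUAL FIELD `ResidB8.toAxial`** (the candidate pin of Proposition 7's axial map at NODE 00's
family of record `famB8OfRecord θ β len = zdGF3 θ.𝔸 θ.L β len ∘ Subtype.val`): member `i ↦ toAxialTower θ.𝔸 θ.L β len _ i.1`.
[cite: Balaban1985RegularSpaces, Prop. 7 p.100 («a gauge transformation u satisfying (1.29) and such that U′ … satisfies (1.19)»)] -/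
def toAxialTowerResid : ∀ i : IdxB8 θ, (famB8OfRecord θ β len i).Cfg → (famB8OfRecord θ β len i).Pert → (famB8OfRecord θ β len i).Pert :=
  fun i => toAxialTower θ.𝔸 θ.L β len (le_trans one_le_two θ.two_le_L) i.1

variable {θ}

/-- **PROPOSITION 7 (repaired constant `530·θ.D`, the carrier's box form of (1.145)) FOR PRINT'S MAP AT THE [B8″] GROUP OF RECORD** — over n05-c's
four-law sub-index `IdxB8SubB θ` (`Ω₀ = ℤᵈ`, №8), at every `θ` with `θ.D ≥ 2`: `B8Prop7TowerAxialIneq145.prop7RepairedC_zdGF3_toAxialTower` at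
`e := (·.1.1)`. [cite: Balaban1985RegularSpaces, Prop. 7 (1.144)–(1.145) p.100 (constant: audit G-adv8-16 ∕ `B8Ineq145`)] -/
theorem prop7RepairedC_famB8OfRecordSubB (hD : 2 ≤ θ.D) :
    B8Ineq145.Prop7RepairedC (530 * (θ.D : ℝ)) (fun j : IdxB8SubB θ => famB8OfRecordSubB θ β len j)
      (fun j => toAxialTowerResid θ β len j.1) :=
  prop7RepairedC_zdGF3_toAxialTower θ.𝔸 θ.L β len hD θ.two_le_L (fun j : IdxB8SubB θ => j.1.1) (fun j => j.1.2)
    (fun j => j.2.toIdxB8Laws.trunc_lt) (fun j => j.2.toIdxB8Laws.trunc_top)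

/-- **… AND AT ITS REPAIRED-CARRIER TWIN** `famB8OfRecordSubBH` (Proposition 7 reads no source: the fields it reads are `rfl`-equal, so the SAME proof
term elaborates). [cite: Balaban1985RegularSpaces, Prop. 7 (1.144)–(1.145) p.100] -/
theorem prop7RepairedC_famB8OfRecordSubBH (hD : 2 ≤ θ.D) :
    B8Ineq145.Prop7RepairedC (530 * (θ.D : ℝ)) (fun j : IdxB8SubB θ => famB8OfRecordSubBH θ β len j)
      (fun j => toAxialTowerResid θ β len j.1) :=
  prop7RepairedC_famB8OfRecordSubB β len hD

#print axioms prop7RepairedC_famB8OfRecordSubB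

end Literature.MathematicalPhysics.QuantumFieldTheory.Balaban1983to89.B8Prop7TowerAxialRecord

end
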